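import Summits.QuantumFields.BalabanUV.Beta.WardLocusInduction
import Literature.MathematicalPhysics.QuantumFieldTheory.Balaban1983to89.Beta.SecondOrderResponse

/-!
# `BalabanUV.Beta.WardLocusSecondOrder` — binder row D1, the WARD binder hW, W-SIDE (W-L4): GENERIC SECOND-ORDER BOOKKEEPING —
# the coarse pure-gauge slice of an2's second-order carrier pieces `vertex2OfK`, `mixOfK` through the column Ward laws of the resolvent

HONEST FRAMING (cell charter, verbatim): «discharging `BetaPertH` makes Bałaban's UV stability UNCONDITIONAL — a real constructive-QFT
result; it is NOT the continuum limit and NOT the Clay problem.»  DERIVED cell leaf (pub-balaban β sub-cell, D1 formalisation swarm seat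
`b2b-balaban-beta-d1-formalise-leaf-10`, gen 2; scoping memo `HOME/b2b-balaban-beta-d1-formalise-leaf-10/g2/W-L4-SCOPING.v1.md`); every
declaration is [folklore] kernel algebra over objects ALREADY in the tree (an2's `SecondOrderResponse` carrier, an1's `KernelWardRelative`
bookkeeping), cited BY NAME; 0 def, no statement of Bałaban's papers typed, no `[cite:]` tag; it instantiates NO binder of the β-function wall.
NOT `BetaPertH`, NOT continuum, NOT Clay.
HONEST DEPENDENCY (cell records, verbatim): «continuum YM on T⁴ ⇐ BetaPertH ∧ nine spine estimates (0/9 proved); BetaPertH ⇐ (D1) ∧ (D4) ∧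
CAP+tail; G-an2-4 gates asym, D1 and NE2/3/4.»
ABSOLUTE RULE (cell charter, verbatim): «No internally-minted statement may enter as a cited fact. Every hypothesis is either kernel-proved in
this package or a verbatim quotation of a PUBLISHED theorem with page reference. The manuscript(s) under audit are NOT citable for their own
disputed steps — they are the thing under adjudication; programme-internal (2001/route/tribunal) claims are never citable.»

WHERE THIS SITS.  After `WardLocusRecursiveEnd` (p211820) the hW binder of the recursive wall-literal candidate v2.26 is EXACTLY its W-side
socket `hWd : divW (W j) y ν y′ = conjW (𝕄 j) 0 V_{νy′} (X j y) 0 (X₂ …) + Nr …` (+ covariance, localisation, parity).  For W-tables built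
by an2's generic Lagrangian-chart carrier `SecondOrderResponse.W2OfK K N S M S₂ M₂ = vertex2OfK K N S₂ + mixOfK K N M₂ + mixOfK-swapped +
dM (K2OfK …) …` the pure-gauge slice `divW` splits into four pieces; this module does the RESOLVENT-SIDE bookkeeping of the first three, for
ANY packed `K` obeying the two COLUMN Ward laws the wall's step propagators obey — (hH) the ℋ-column law (leaf-07, all `j`) and (hMw) the
MULTIPLIER-ROW law `Σ_μ Δ_μ colM K = 0` (§2: for the wall's `G_j` it is an2's second-slot co-closedness of `wΦ`, via leaf-10's
`WardLocusStep.E2_colDiv_eq_zero` and `WardLocusInduction.mmRead_coDressKBmAt_KInvStep`):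
* §1 `divV_vertexOfK_of_bdd` — an1's `KernelWardRelative.divV_vertexOfK` under a uniform ENTRY bound on the table (instead of `LocStencil`),
  the form the second-order tables' slices come in; `divV_vertexOfM` — its `colM` twin: `divV (vertexOfM K N M) y = Σ_ρ cwsum N (Σ_μ Δ_μ colM) (M ρ)`;
  `divV_vertexOfM_eq_zero` under (hMw).
* §2 `colM_ward_coDressKBmAt_KInvStep` — (hMw) for the wall's `G_j = coDressKBmAt ρ Lc (KInvStep Lc j)`, every `j`, every root.
* §3 (B1) `divW_vertex2OfK`: `divW (vertex2OfK K N S₂) y ν y′ = cH • Σ_{v ∈ box} divV (fun κ u ↦ vertexOfK K N (S₂ κ u) ν y′) (N•y + v)` —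
  the slice of the bi-vertex is `cH` times the BLOCK pure-gauge contraction of the first table slot, still dressed in the second;
  (B2) `divW_mixOfK`: the same through `vertexOfM`; (B3) `divW_mixOfK_swap_eq_zero`: the swapped mixed piece has NO pure-gauge slice under (hMw).
What is NOT here (memo §2): the fourth piece `dM (K2OfK …)` (column divergence of `−K∘D∘K`), the TABLE-LEVEL second-order laws (T2-S₂)/(T2-M₂)
and the column-contraction law (T1-col), and the assembly into `conjW` — statement shapes await the row owner's W-literal (Q-W1) and an1's
sign-off (Q-W2).  Nothing of (W-L4) is discharged by this file.
-/

noncomputable section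

open Finset
open scoped BigOperators
open Literature.MathematicalPhysics.QuantumFieldTheory
open Literature.MathematicalPhysics.QuantumFieldTheory.Balaban1983to89
open Literature.MathematicalPhysics.QuantumFieldTheory.Balaban1983to89.Beta
open B12Sec2to5 (l1 l1_nonneg)
open B6BondElimination (unitVec)
open ExpKernelCalculus (MKer Decays)
open KernelWard (divV divW)
open AffineAveraging (box toSite)
open OneStepResolventKernel (Fib wsum)
open OneStepKernelFamily (KInvStep colH abs_colH_le vertexOfK)
open InterLevelTransport (cwsum cwsum_apply)
open SecondOrderResponse (colM abs_colM_le vertexOfM vertex2OfK mixOfK)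
open BalabanStepJetsSucc (mmRead_inl_inl E2 l1_sub_le_l1_smul_sub)
open Summit.QuantumFields.BalabanUV.Beta.ChartConjugationReflection (summable_abs_colH)
open Summit.QuantumFields.BalabanUV.Beta.AxialDressingRooted (coDressKBmAt)
open Summit.QuantumFields.BalabanUV.Beta.KernelWardRelative (gaugeWt wsum_gaugeWt)
open AveragingWardStencils (b6UnitVec_eq)
open Summit.QuantumFields.BalabanUV.Beta.WardLocusStep (E2_colDiv_eq_zero)
open Summit.QuantumFields.BalabanUV.Beta.WardLocusInduction (mmRead_coDressKBmAt_KInvStep)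

namespace Summit.QuantumFields.BalabanUV.Beta.WardLocusSecondOrder

variable {d N : ℕ}

/-! ## §1 The coarse divergence of the two chain-rule vertices under entry bounds -/

section Vertices

/-- [folklore] **an1's `divV_vertexOfK` UNDER A UNIFORM ENTRY BOUND**: for a decaying `K` and a table family with `|S κ u x z a b| ≤ B`,
`divV (vertexOfK K N S) y = Σ_κ′ wsum (Σ_μ Δ_μ colH K N · y κ′) (S κ′)` (the proof of `KernelWardRelative.divV_vertexOfK` uses only the bound). -/
theorem divV_vertexOfK_of_bdd {K : MKer (d + 1) (Fib d)} (hK : ∃ δ C : ℝ, 0 < δ ∧ 0 ≤ C ∧ Decays K C δ)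
    {S : Fin (d + 1) → (Fin (d + 1) → ℤ) → MKer (d + 1) (Fib d)} {B : ℝ} (hB : ∀ κ' u x z a b, |S κ' u x z a b| ≤ B)
    (y : Fin (d + 1) → ℤ) :
    divV (vertexOfK K N S) y = ∑ κ', wsum (fun u => ∑ μ, (colH K N μ (y - unitVec μ) κ' u - colH K N μ y κ' u)) (S κ') := by
  have hs : ∀ (μ : Fin (d + 1)) (w : Fin (d + 1) → ℤ) (κ' : Fin (d + 1)) (x z : Fin (d + 1) → ℤ) (a b : Fib d),
      Summable fun u => colH K N μ w κ' u * S κ' u x z a b := fun μ w κ' x z a b =>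
    Summable.of_norm_bounded ((summable_abs_colH (N := N) hK μ w κ').mul_right B) (fun u => by
      rw [Real.norm_eq_abs, abs_mul]; exact mul_le_mul_of_nonneg_left (hB κ' u x z a b) (abs_nonneg _))
  funext x z a b
  simp only [KernelWard.divV, Finset.sum_apply, Pi.sub_apply, vertexOfK, OneStepResolventKernel.wsum]
  simp only [← Finset.sum_sub_distrib]
  rw [Finset.sum_comm]
  refine Finset.sum_congr rfl fun κ' _ => ?_
  have e : ∀ μ : Fin (d + 1), (∑' u, colH K N μ (y - unitVec μ) κ' u * S κ' u x z a b) - (∑' u, colH K N μ y κ' u * S κ' u x z a b)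
      = ∑' u, (colH K N μ (y - unitVec μ) κ' u - colH K N μ y κ' u) * S κ' u x z a b := fun μ => by
    rw [← (hs μ _ κ' x z a b).tsum_sub (hs μ y κ' x z a b)]
    exact tsum_congr fun u => by ring
  simp only [e]
  rw [← Summable.tsum_finsetSum (fun μ _ => (((hs μ (y - unitVec μ) κ' x z a b).sub (hs μ y κ' x z a b)).congr
    (fun u => by show _ - _ = _; ring)))]
  exact tsum_congr fun u => by rw [Finset.sum_mul]

variable [NeZero N]

/-- [folklore] **THE MULTIPLIER COLUMNS OF A DECAYING KERNEL ARE ABSOLUTELY SUMMABLE** over the coarse index. -/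
theorem summable_abs_colM {K : MKer (d + 1) (Fib d)} (hK : ∃ δ C : ℝ, 0 < δ ∧ 0 ≤ C ∧ Decays K C δ) (μ : Fin (d + 1))
    (y : Fin (d + 1) → ℤ) (ρ : Fin (d + 1)) : Summable fun w => |colM K N μ y ρ w| := by
  obtain ⟨δ, C, hδ, hC, hK⟩ := hK
  have hN : 1 ≤ N := Nat.one_le_iff_ne_zero.2 (NeZero.ne N)
  refine Summable.of_nonneg_of_le (fun w => abs_nonneg _) (fun w => (abs_colM_le (N := N) hK μ y ρ w).trans ?_)
    ((ExpKernelCalculus.summable_exp_shift' hδ y).mul_left C)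
  refine mul_le_mul_of_nonneg_left (Real.exp_le_exp.2 ?_) hC
  have h := l1_sub_le_l1_smul_sub (d := d) hN w y
  nlinarith

/-- [folklore] **THE `colM` TWIN OF an1's BOOKKEEPING**: for a decaying `K` and a coarse-indexed table family with `|M ρ w x z a b| ≤ B`,
the coarse divergence of the multiplier chain-rule vertex is the coarse superposition of the tables with the coarse divergence of the MULTIPLIER
columns as weights: `divV (vertexOfM K N M) y = Σ_ρ cwsum N (Σ_μ Δ_μ colM K N · y ρ) (M ρ)`. -/
theorem divV_vertexOfM_of_bdd {K : MKer (d + 1) (Fib d)} (hK : ∃ δ C : ℝ, 0 < δ ∧ 0 ≤ C ∧ Decays K C δ)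
    {M : Fin (d + 1) → (Fin (d + 1) → ℤ) → MKer (d + 1) (Fib d)} {B : ℝ} (hB : ∀ ρ w x z a b, |M ρ w x z a b| ≤ B)
    (y : Fin (d + 1) → ℤ) :
    divV (vertexOfM K N M) y = fun x z a b =>
      ∑ ρ, cwsum N (fun w => ∑ μ, (colM K N μ (y - unitVec μ) ρ w - colM K N μ y ρ w)) (M ρ) x z a b := by
  have hs : ∀ (μ : Fin (d + 1)) (y₀ : Fin (d + 1) → ℤ) (ρ : Fin (d + 1)) (x z : Fin (d + 1) → ℤ) (a b : Fib d),
      Summable fun w => colM K N μ y₀ ρ w * M ρ w x z a b := fun μ y₀ ρ x z a b =>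
    Summable.of_norm_bounded ((summable_abs_colM (N := N) hK μ y₀ ρ).mul_right B) (fun w => by
      rw [Real.norm_eq_abs, abs_mul]; exact mul_le_mul_of_nonneg_left (hB ρ w x z a b) (abs_nonneg _))
  funext x z a b
  simp only [KernelWard.divV, Finset.sum_apply, Pi.sub_apply, vertexOfM, cwsum_apply]
  simp only [← Finset.sum_sub_distrib]
  rw [Finset.sum_comm]
  refine Finset.sum_congr rfl fun ρ _ => ?_
  have e : ∀ μ : Fin (d + 1), (∑' w, colM K N μ (y - unitVec μ) ρ w * M ρ w x z a b) - (∑' w, colM K N μ y ρ w * M ρ w x z a b)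
      = ∑' w, (colM K N μ (y - unitVec μ) ρ w - colM K N μ y ρ w) * M ρ w x z a b := fun μ => by
    rw [← (hs μ _ ρ x z a b).tsum_sub (hs μ y ρ x z a b)]
    exact tsum_congr fun w => by ring
  simp only [e]
  rw [← Summable.tsum_finsetSum (fun μ _ => (((hs μ (y - unitVec μ) ρ x z a b).sub (hs μ y ρ x z a b)).congr
    (fun w => by show _ - _ = _; ring)))]
  exact tsum_congr fun w => by rw [Finset.sum_mul]

/-- [folklore] **UNDER THE MULTIPLIER-ROW WARD LAW THE MULTIPLIER VERTEX HAS NO PURE-GAUGE DIVERGENCE**: if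
`Σ_μ (colM K N μ (y − e_μ) ρ w − colM K N μ y ρ w) = 0` for all `ρ, w` then `divV (vertexOfM K N M) y = 0` (bounded tables). -/
theorem divV_vertexOfM_eq_zero {K : MKer (d + 1) (Fib d)} (hK : ∃ δ C : ℝ, 0 < δ ∧ 0 ≤ C ∧ Decays K C δ)
    {M : Fin (d + 1) → (Fin (d + 1) → ℤ) → MKer (d + 1) (Fib d)} {B : ℝ} (hB : ∀ ρ w x z a b, |M ρ w x z a b| ≤ B)
    {y : Fin (d + 1) → ℤ} (hMw : ∀ (ρ : Fin (d + 1)) (w : Fin (d + 1) → ℤ), ∑ μ, (colM K N μ (y - unitVec μ) ρ w - colM K N μ y ρ w) = 0) :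
    divV (vertexOfM K N M) y = 0 := by
  rw [divV_vertexOfM_of_bdd hK hB y]
  funext x z a b
  simp only [cwsum_apply, hMw, zero_mul, tsum_zero, Finset.sum_const_zero, Pi.zero_apply]

end Vertices

/-! ## §2 The multiplier-row Ward law of the wall's step propagators -/

section Wall

variable {Lc : ℕ} [NeZero Lc]

/-- [folklore] **THE MULTIPLIER COLUMNS OF THE WALL'S STEP PROPAGATOR ARE THE VALUE HESSIAN** read at coarse points:
`colM (coDressKBmAt ρ Lc (KInvStep Lc j)) Lc μ y ρ′ w = E2 d Lc (j+1) w y (inl ρ′) (inl μ)` (`mmRead_coDressKBmAt_KInvStep`). -/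
theorem colM_coDressKBmAt_KInvStep (ρ : Fin (d + 1) → ℤ) (j : ℕ) (μ : Fin (d + 1)) (y : Fin (d + 1) → ℤ) (ρ' : Fin (d + 1))
    (w : Fin (d + 1) → ℤ) :
    colM (coDressKBmAt ρ Lc (KInvStep (d := d) Lc j)) Lc μ y ρ' w = E2 d Lc (j + 1) w y (Sum.inl ρ') (Sum.inl μ) := by
  rw [← mmRead_coDressKBmAt_KInvStep ρ j, mmRead_inl_inl]
  rfl

/-- [folklore] **(hMw) FOR THE WALL'S STEP PROPAGATORS**: the multiplier rows of `G_j = coDressKBmAt ρ Lc (KInvStep Lc j)` have zero coarse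
divergence in the column index — `Σ_μ (colM G_j Lc μ (y − e_μ) ρ′ w − colM G_j Lc μ y ρ′ w) = 0` — an2's second-slot co-closedness of the
multiplier response `wΦ` (leaf-10's `WardLocusStep.E2_colDiv_eq_zero`), every `j`, every root. -/
theorem colM_ward_coDressKBmAt_KInvStep (ρ : Fin (d + 1) → ℤ) (j : ℕ) (y : Fin (d + 1) → ℤ) (ρ' : Fin (d + 1))
    (w : Fin (d + 1) → ℤ) :
    ∑ μ, (colM (coDressKBmAt ρ Lc (KInvStep (d := d) Lc j)) Lc μ (y - unitVec μ) ρ' w -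
      colM (coDressKBmAt ρ Lc (KInvStep (d := d) Lc j)) Lc μ y ρ' w) = 0 := by
  simp only [colM_coDressKBmAt_KInvStep, b6UnitVec_eq]
  exact E2_colDiv_eq_zero (d := d) (Lc := Lc) (j + 1) w y (Sum.inl ρ')

end Wall

/-! ## §3 The pure-gauge slice of the second-order carrier pieces (B1), (B2), (B3) -/

section Pieces

variable [NeZero N]

omit [NeZero N] in
/-- [folklore] ENTRY BOUND of a chain-rule vertex through the ℋ-columns over a bounded table. -/
theorem abs_vertexOfK_le {K : MKer (d + 1) (Fib d)} (hK : ∃ δ C : ℝ, 0 < δ ∧ 0 ≤ C ∧ Decays K C δ)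
    {S : Fin (d + 1) → (Fin (d + 1) → ℤ) → MKer (d + 1) (Fib d)} {B : ℝ} (hB : ∀ κ u x z a b, |S κ u x z a b| ≤ B)
    (μ : Fin (d + 1)) (y x z : Fin (d + 1) → ℤ) (a b : Fib d) :
    |vertexOfK K N S μ y x z a b| ≤ ∑ κ, (∑' u, |colH K N μ y κ u|) * B := by
  unfold vertexOfK
  refine (Finset.abs_sum_le_sum_abs _ _).trans (Finset.sum_le_sum fun κ _ => ?_)
  unfold OneStepResolventKernel.wsum
  have hs : Summable fun u => |colH K N μ y κ u| * B := (summable_abs_colH (N := N) hK μ y κ).mul_right B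
  have hle : ∀ u, |colH K N μ y κ u * S κ u x z a b| ≤ |colH K N μ y κ u| * B := fun u => by
    rw [abs_mul]; exact mul_le_mul_of_nonneg_left (hB κ u x z a b) (abs_nonneg _)
  have hs' : Summable fun u => colH K N μ y κ u * S κ u x z a b :=
    Summable.of_norm_bounded hs (fun u => by rw [Real.norm_eq_abs]; exact hle u)
  calc |∑' u, colH K N μ y κ u * S κ u x z a b| ≤ ∑' u, |colH K N μ y κ u * S κ u x z a b| := by
        rw [← Real.norm_eq_abs]
        exact norm_tsum_le_tsum_norm hs'.abs
    _ ≤ ∑' u, |colH K N μ y κ u| * B := hs'.abs.tsum_le_tsum hle hs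
    _ = (∑' u, |colH K N μ y κ u|) * B := tsum_mul_right

/-- [folklore] ENTRY BOUND of a multiplier chain-rule vertex over a bounded coarse-indexed table. -/
theorem abs_vertexOfM_le {K : MKer (d + 1) (Fib d)} (hK : ∃ δ C : ℝ, 0 < δ ∧ 0 ≤ C ∧ Decays K C δ)
    {M : Fin (d + 1) → (Fin (d + 1) → ℤ) → MKer (d + 1) (Fib d)} {B : ℝ} (hB : ∀ ρ w x z a b, |M ρ w x z a b| ≤ B)
    (μ : Fin (d + 1)) (y x z : Fin (d + 1) → ℤ) (a b : Fib d) :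
    |vertexOfM K N M μ y x z a b| ≤ ∑ ρ, (∑' w, |colM K N μ y ρ w|) * B := by
  unfold vertexOfM
  refine (Finset.abs_sum_le_sum_abs _ _).trans (Finset.sum_le_sum fun ρ _ => ?_)
  rw [cwsum_apply]
  have hs : Summable fun w => |colM K N μ y ρ w| * B := (summable_abs_colM (N := N) hK μ y ρ).mul_right B
  have hle : ∀ w, |colM K N μ y ρ w * M ρ w x z a b| ≤ |colM K N μ y ρ w| * B := fun w => by
    rw [abs_mul]; exact mul_le_mul_of_nonneg_left (hB ρ w x z a b) (abs_nonneg _)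
  have hs' : Summable fun w => colM K N μ y ρ w * M ρ w x z a b :=
    Summable.of_norm_bounded hs (fun w => by rw [Real.norm_eq_abs]; exact hle w)
  calc |∑' w, colM K N μ y ρ w * M ρ w x z a b| ≤ ∑' w, |colM K N μ y ρ w * M ρ w x z a b| := by
        rw [← Real.norm_eq_abs]
        exact norm_tsum_le_tsum_norm hs'.abs
    _ ≤ ∑' w, |colM K N μ y ρ w| * B := hs'.abs.tsum_le_tsum hle hs
    _ = (∑' w, |colM K N μ y ρ w|) * B := tsum_mul_right

/-- [folklore] **(B1) THE PURE-GAUGE SLICE OF THE BI-VERTEX.**  For a decaying `K` (blocking `N ≥ 1`) whose ℋ-columns obey the Ward law (hH)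
with constant `cH`, and a bi-table `S₂` with a uniform entry bound: the coarse pure-gauge slice (in the first coarse bond) of
`vertex2OfK K N S₂` is `cH` times the BLOCK pure-gauge contraction of the first table slot, the second slot still dressed by `K`:
`divW (vertex2OfK K N S₂) y ν y′ = cH • Σ_{v ∈ box} divV (fun κ u ↦ vertexOfK K N (S₂ κ u) ν y′) (N•y + v)`. -/
theorem divW_vertex2OfK {K : MKer (d + 1) (Fib d)} (hK : ∃ δ C : ℝ, 0 < δ ∧ 0 ≤ C ∧ Decays K C δ)
    {S₂ : Fin (d + 1) → (Fin (d + 1) → ℤ) → Fin (d + 1) → (Fin (d + 1) → ℤ) → MKer (d + 1) (Fib d)} {B₂ : ℝ}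
    (hB₂ : ∀ κ u κ' u' x z a b, |S₂ κ u κ' u' x z a b| ≤ B₂) (cH : ℝ)
    (hH : ∀ (y : Fin (d + 1) → ℤ) (κ' : Fin (d + 1)) (u : Fin (d + 1) → ℤ),
      ∑ μ, (colH K N μ (y - unitVec μ) κ' u - colH K N μ y κ' u) = cH * gaugeWt N y κ' u)
    (y : Fin (d + 1) → ℤ) (ν : Fin (d + 1)) (y' : Fin (d + 1) → ℤ) :
    divW (vertex2OfK K N S₂) y ν y' =
      cH • ∑ v ∈ box (d + 1) N, divV (fun κ u => vertexOfK K N (S₂ κ u) ν y') ((N : ℤ) • y + toSite v) := by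
  have hN : 1 ≤ N := Nat.one_le_iff_ne_zero.2 (NeZero.ne N)
  -- the slice is the coarse divergence of the outer chain-rule vertex over the table `T κ u := vertexOfK K N (S₂ κ u) ν y′`
  have eW : divW (vertex2OfK K N S₂) y ν y' = divV (vertexOfK K N (fun κ u => vertexOfK K N (S₂ κ u) ν y')) y := by
    simp only [KernelWard.divW, KernelWard.divV, SecondOrderResponse.vertex2OfK]
  have hT : ∀ κ u x z a b, |vertexOfK K N (S₂ κ u) ν y' x z a b| ≤ ∑ κ₁, (∑' u₁, |colH K N ν y' κ₁ u₁|) * B₂ :=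
    fun κ u x z a b => abs_vertexOfK_le hK (fun κ₁ u₁ x z a b => hB₂ κ u κ₁ u₁ x z a b) ν y' x z a b
  rw [eW, divV_vertexOfK_of_bdd hK hT y]
  have e : ∀ κ' : Fin (d + 1), wsum (fun u => ∑ μ, (colH K N μ (y - unitVec μ) κ' u - colH K N μ y κ' u))
      (fun u => vertexOfK K N (S₂ κ' u) ν y')
      = cH • ∑ v ∈ box (d + 1) N, (vertexOfK K N (S₂ κ' ((N : ℤ) • y + toSite v - unitVec κ')) ν y' -
          vertexOfK K N (S₂ κ' ((N : ℤ) • y + toSite v)) ν y') := by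
    intro κ'
    rw [← wsum_gaugeWt hN cH y κ' (fun u => vertexOfK K N (S₂ κ' u) ν y')]
    congr 1
    funext u
    exact hH y κ' u
  simp only [e, ← Finset.smul_sum]
  congr 1
  rw [Finset.sum_comm]
  refine Finset.sum_congr rfl fun v _ => ?_
  simp only [KernelWard.divV]

/-- [folklore] **(B2) THE PURE-GAUGE SLICE OF THE MIXED BI-VERTEX** (field slot outer, multiplier slot inner): for a decaying `K` with (hH)
and a mixed table `M₂` with a uniform entry bound,
`divW (mixOfK K N M₂) y ν y′ = cH • Σ_{v ∈ box} divV (fun κ u ↦ vertexOfM K N (M₂ κ u) ν y′) (N•y + v)`. -/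
theorem divW_mixOfK {K : MKer (d + 1) (Fib d)} (hK : ∃ δ C : ℝ, 0 < δ ∧ 0 ≤ C ∧ Decays K C δ)
    {M₂ : Fin (d + 1) → (Fin (d + 1) → ℤ) → Fin (d + 1) → (Fin (d + 1) → ℤ) → MKer (d + 1) (Fib d)} {B₂ : ℝ}
    (hB₂ : ∀ κ u ρ w x z a b, |M₂ κ u ρ w x z a b| ≤ B₂) (cH : ℝ)
    (hH : ∀ (y : Fin (d + 1) → ℤ) (κ' : Fin (d + 1)) (u : Fin (d + 1) → ℤ),
      ∑ μ, (colH K N μ (y - unitVec μ) κ' u - colH K N μ y κ' u) = cH * gaugeWt N y κ' u)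
    (y : Fin (d + 1) → ℤ) (ν : Fin (d + 1)) (y' : Fin (d + 1) → ℤ) :
    divW (mixOfK K N M₂) y ν y' =
      cH • ∑ v ∈ box (d + 1) N, divV (fun κ u => vertexOfM K N (M₂ κ u) ν y') ((N : ℤ) • y + toSite v) := by
  have hN : 1 ≤ N := Nat.one_le_iff_ne_zero.2 (NeZero.ne N)
  have eW : divW (mixOfK K N M₂) y ν y' = divV (vertexOfK K N (fun κ u => vertexOfM K N (M₂ κ u) ν y')) y := by
    simp only [KernelWard.divW, KernelWard.divV, SecondOrderResponse.mixOfK]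
  have hT : ∀ κ u x z a b, |vertexOfM K N (M₂ κ u) ν y' x z a b| ≤ ∑ ρ, (∑' w, |colM K N ν y' ρ w|) * B₂ :=
    fun κ u x z a b => abs_vertexOfM_le hK (fun ρ w x z a b => hB₂ κ u ρ w x z a b) ν y' x z a b
  rw [eW, divV_vertexOfK_of_bdd hK hT y]
  have e : ∀ κ' : Fin (d + 1), wsum (fun u => ∑ μ, (colH K N μ (y - unitVec μ) κ' u - colH K N μ y κ' u))
      (fun u => vertexOfM K N (M₂ κ' u) ν y')
      = cH • ∑ v ∈ box (d + 1) N, (vertexOfM K N (M₂ κ' ((N : ℤ) • y + toSite v - unitVec κ')) ν y' -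
          vertexOfM K N (M₂ κ' ((N : ℤ) • y + toSite v)) ν y') := by
    intro κ'
    rw [← wsum_gaugeWt hN cH y κ' (fun u => vertexOfM K N (M₂ κ' u) ν y')]
    congr 1
    funext u
    exact hH y κ' u
  simp only [e, ← Finset.smul_sum]
  congr 1
  rw [Finset.sum_comm]
  refine Finset.sum_congr rfl fun v _ => ?_
  simp only [KernelWard.divV]

/-- [folklore] **(B3) THE SWAPPED MIXED PIECE HAS NO PURE-GAUGE SLICE** under the multiplier-row Ward law: with the first coarse bond `(μ, y)`
read through the MULTIPLIER columns (`mixOfK K N M₂ ν y′ μ y = vertexOfK K N (fun κ u ↦ vertexOfM K N (M₂ κ u) μ y) ν y′`) and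
`Σ_μ Δ_μ colM K = 0` (for the wall's `G_j`: `colM_ward_coDressKBmAt_KInvStep`),
`divW (fun μ y ν y′ ↦ mixOfK K N M₂ ν y′ μ y) y ν y′ = 0`. -/
theorem divW_mixOfK_swap_eq_zero {K : MKer (d + 1) (Fib d)} (hK : ∃ δ C : ℝ, 0 < δ ∧ 0 ≤ C ∧ Decays K C δ)
    {M₂ : Fin (d + 1) → (Fin (d + 1) → ℤ) → Fin (d + 1) → (Fin (d + 1) → ℤ) → MKer (d + 1) (Fib d)} {B₂ : ℝ}
    (hB₂ : ∀ κ u ρ w x z a b, |M₂ κ u ρ w x z a b| ≤ B₂)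
    (hMw : ∀ (y : Fin (d + 1) → ℤ) (ρ : Fin (d + 1)) (w : Fin (d + 1) → ℤ),
      ∑ μ, (colM K N μ (y - unitVec μ) ρ w - colM K N μ y ρ w) = 0)
    (y : Fin (d + 1) → ℤ) (ν : Fin (d + 1)) (y' : Fin (d + 1) → ℤ) :
    divW (fun μ y ν y' => mixOfK K N M₂ ν y' μ y) y ν y' = 0 := by
  -- summability of the outer superposition, uniformly bounded inner vertices
  have hT : ∀ (μ : Fin (d + 1)) (w : Fin (d + 1) → ℤ) (κ : Fin (d + 1)) (u x z : Fin (d + 1) → ℤ) (a b : Fib d),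
      |vertexOfM K N (M₂ κ u) μ w x z a b| ≤ ∑ ρ, (∑' w', |colM K N μ w ρ w'|) * B₂ :=
    fun μ w κ u x z a b => abs_vertexOfM_le hK (fun ρ w' x z a b => hB₂ κ u ρ w' x z a b) μ w x z a b
  have hs : ∀ (μ : Fin (d + 1)) (w : Fin (d + 1) → ℤ) (κ : Fin (d + 1)) (x z : Fin (d + 1) → ℤ) (a b : Fib d),
      Summable fun u => colH K N ν y' κ u * vertexOfM K N (M₂ κ u) μ w x z a b := fun μ w κ x z a b =>
    Summable.of_norm_bounded ((summable_abs_colH (N := N) hK ν y' κ).mul_right (∑ ρ, (∑' w', |colM K N μ w ρ w'|) * B₂))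
      (fun u => by rw [Real.norm_eq_abs, abs_mul]; exact mul_le_mul_of_nonneg_left (hT μ w κ u x z a b) (abs_nonneg _))
  -- the inner multiplier vertex has zero divergence at every table index
  have hz : ∀ (κ : Fin (d + 1)) (u : Fin (d + 1) → ℤ), divV (vertexOfM K N (M₂ κ u)) y = 0 := fun κ u =>
    divV_vertexOfM_eq_zero hK (fun ρ w x z a b => hB₂ κ u ρ w x z a b) (hMw y)
  funext x z a b
  simp only [KernelWard.divW, Finset.sum_apply, Pi.sub_apply, Pi.zero_apply, SecondOrderResponse.mixOfK, vertexOfK,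
    OneStepResolventKernel.wsum]
  simp only [← Finset.sum_sub_distrib]
  rw [Finset.sum_comm]
  refine Finset.sum_eq_zero fun κ _ => ?_
  have e : ∀ μ : Fin (d + 1),
      (∑' u, colH K N ν y' κ u * vertexOfM K N (M₂ κ u) μ (y - unitVec μ) x z a b) -
        (∑' u, colH K N ν y' κ u * vertexOfM K N (M₂ κ u) μ y x z a b)
      = ∑' u, colH K N ν y' κ u * (vertexOfM K N (M₂ κ u) μ (y - unitVec μ) x z a b - vertexOfM K N (M₂ κ u) μ y x z a b) :=
    fun μ => by
    rw [← (hs μ _ κ x z a b).tsum_sub (hs μ y κ x z a b)]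
    exact tsum_congr fun u => by ring
  simp only [e]
  rw [← Summable.tsum_finsetSum (fun μ _ => (((hs μ (y - unitVec μ) κ x z a b).sub (hs μ y κ x z a b)).congr
    (fun u => by show _ - _ = _; ring)))]
  refine (tsum_congr fun u => ?_).trans tsum_zero
  have hzu := congr_fun (congr_fun (congr_fun (congr_fun (hz κ u) x) z) a) b
  simp only [KernelWard.divV, Finset.sum_apply, Pi.sub_apply, Pi.zero_apply] at hzu
  rw [← Finset.mul_sum, hzu, mul_zero]

end Pieces

end Summit.QuantumFields.BalabanUV.Beta.WardLocusSecondOrder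

end
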